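import Summits.NavierStokesRegularity.FluidComputer.PalasekTowerRegisterGlobal
import Summits.NavierStokesRegularity.FluidComputer.PalasekTowerRegisterWindow

/-!
# REGISTER v2.3′: the SMALL-DATA CLASSICAL ENGINE (typed hypothesis) and the class of TINY anchored hosts

Cell `ns-blowup`, seat `ns-blowup-ecbridge-4` (g3; GROUP C «BRIDGE SUPPORT» of the route
`PalasekTowerBreakdown`, crux `EpisodeBaseG`, item stmt-NavierStokesRegularity-19179, line
`Cruxes/EpisodeBase/Lines/birth.lean` whose one open stub `stub_first_episodeR : FirstEpisodeR` is the
∀-over-level-0-hosts PLACEHOLDER of the planner's R2 of record). LABEL: E–C typing (KERNEL vocabulary: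
two `Prop` definitions with bodies). WHAT THIS IS NOT: not Navier–Stokes evidence — nothing below is
asserted or inhabited; `SmallDataClassicalEngine` is an UNPROVED typed HYPOTHESIS (the global /
small-data half of the cell's Fourier–Picard / Kato programme, refuter4 K-ROW K56 (C), planner RULING
2026-08-26 09:45Z (r3): «the Negative-lane plan `firstEpisodeR_false_of_<H>` is WELCOME as a landed lemma
under `Theorems/EpisodeBase/Negative/`»), and `TinyAnchoredHosts` is a CONSTRUCTION TARGET (the register
admits globally anchored level-`0` hosts of arbitrarily small scale-invariant size; a companion file of this
seat builds them). Their conjunction kills the ∀-placeholder: `Theorems/EpisodeBase/Negative/…`.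

## The engine hypothesis `SmallDataClassicalEngine ν`

Kato's small-data theory of the incompressible Navier–Stokes system on `ℝ³` WITH a bounded, confined,
Clay-class force, in the output form a classical-solution interface consumes. DIMENSIONLESS SIZES of the
data on a slab `[t₀, t₁] × ℝ³` (`W := t₁ − t₀`): for the datum `u₀` the scale-invariant
`δ₁ := ‖u₀‖_{L³} / ν`; for a force with `‖g‖ ≤ M` on the slab, vanishing off the ball `B̄(0, R)`, the
Duhamel sizes `δ₂ := W^{1/2} M R² / ν^{3/2}` (its `L^∞_t L^{3/2}_x` weight, `‖g(t)‖_{3/2} ≲ M R²`) and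
`δ₃ := W^{3/4} M R^{3/2} / ν^{5/4}` (its `L^∞_t L²_x` weight in the `(νt)^{1/2}`-weighted sup norm).
STATEMENT: there is `ε > 0` such that whenever `δ₁ + δ₂ + δ₃ ≤ ε` (datum smooth, compactly supported,
divergence free; force smooth on the closed half-space with Fefferman's decay), the forced system has a
CLASSICAL solution on `[t₀, t₁]` from `u₀` at `t₀`, bounded, of finite energy, whose final slice obeys the
Kato bound `sup_x ‖v(t₁, x)‖ ≤ ε⁻¹ (δ₁ + δ₂ + δ₃) (ν / W)^{1/2}`. (Kato 1984: mild solutions in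
`C([0,T]; L³) ∩ {t^{1/2} u ∈ L^∞}`, global and decaying for small `‖u₀‖₃`; the forced small-data
statement with the semigroup weights above is the textbook variant, e.g. Lemarié-Rieusset 2002, Ch. 15;
smoothness of the mild solution for smooth data is classical.) It is NOT proved in the tree; it is the
`H` of the planner-sanctioned negative lemma and a target of the cell's engine programme
(`NSFourierData`, `ForcedFourierForceData`, …). The sup-norm / Fourier-`L¹` local engines do NOT imply it
(their smallness is not scale invariant; register-fixed `W · Y₀² / ν ≈ 326`, refuter4 K53).

## The host class `TinyAnchoredHosts`

For every `δ > 0`: a pinned (`Λ = 8`, `θ = 6/5`), rigid, quiet schedule on the wide-base rates of ball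
radius `≤ δ`, carrying a registered, globally anchored LEVEL-`0` stage (`Margins.routeG`, unit viscosity)
whose readout slice `u(τ₀)` is compactly supported with `‖u(τ₀)‖_{L³} ≤ δ`. (A level-`0` host is free to be
a blob of speed exactly `Y₀` and arbitrarily small size `a`: speed floor by value, strain `Y₀/a ≥ A₀`, the
core ledger by the winding lever of `Theorems/HeredityAtOne/Negative/CoreLedgerWinding.lean`, and the
GLOBAL ANCHOR by a PUSHED, flat, even profile — `Du(τ₀)(x₀) = 0`, `Δu(τ₀)(x₀) = 0`, `∇p(τ₀, x₀) = 0` at the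
unique argmax, rising speed `⟪u, ∂ₜu⟫(τ₀, x₀) = (c₄/2) Y₀² > 0` paid by the admissible push; refuter4 K56 (C)
with the anchor repaired. Constructed in the companion file; here only the class is typed.)

References: T. Kato, Math. Z. 187 (1984) 471–480, Thm. 1–4 [cite: Kato1984, Thm. 1–4];
P. G. Lemarié-Rieusset, *Recent developments in the Navier–Stokes problem* (2002), Ch. 15
[cite: LemarieRieusset2002, Ch. 15]; S. Palasek, arXiv:2605.13827 §3.3–§4 [cite: Palasek2026ElementaryModel, §3.3];
C. L. Fefferman, Clay problem description, (4)–(7) [cite: FeffermanClay2006, (4) (5) (6) (7)].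
-/

noncomputable section

namespace Summit.NavierStokesRegularity.FluidComputer.PalasekTowerClayBridge

open Set MeasureTheory Filter Topology Function
open scoped ENNReal ContDiff NNReal

open Literature.Analysis.FluidPDE

/-! ## §1 The small-data classical engine (typed hypothesis, NOT proved) -/

/-- **THE SMALL-DATA CLASSICAL ENGINE at viscosity `ν`** (typed HYPOTHESIS; Kato's small-data theory with
a bounded confined Clay-class force, classical output). There is `ε > 0` such that: for every slab
`[t₀, t₁]`, `0 ≤ t₀ < t₁`, every smooth compactly supported divergence-free datum `u₀`, every force `g`
smooth on the closed half-space with Fefferman's decay, vanishing off `B̄(0, R)` and bounded by `M` on the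
slab, IF the dimensionless size `δ₁ + δ₂ + δ₃ ≤ ε` (`δ₁ = ‖u₀‖₃/ν`, `δ₂ = W^{1/2} M R²/ν^{3/2}`,
`δ₃ = W^{3/4} M R^{3/2}/ν^{5/4}`, `W = t₁ − t₀`), THEN there is a classical solution `(v, q)` of the forced
system on `[t₀, t₁] × ℝ³` with `v(t₀) = u₀`, bounded, of finite energy, with
`‖v(t₁, x)‖ ≤ ε⁻¹ (δ₁ + δ₂ + δ₃) (ν/W)^{1/2}` for all `x`. NOT proved here; NOT a tree theorem.
[cite: Kato1984, Thm. 1–4] [cite: LemarieRieusset2002, Ch. 15] -/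
@[conjecture] def SmallDataClassicalEngine (ν : ℝ) : Prop :=
  ∃ ε : ℝ, 0 < ε ∧
    ∀ (t₀ t₁ : ℝ), 0 ≤ t₀ → t₀ < t₁ →
    ∀ (u₀ : EuclideanSpace ℝ (Fin 3) → EuclideanSpace ℝ (Fin 3))
      (g : ℝ → EuclideanSpace ℝ (Fin 3) → EuclideanSpace ℝ (Fin 3)) (R M : ℝ),
      ContDiff ℝ ∞ u₀ → HasCompactSupport u₀ → VectorCalculus.IsDivFree u₀ →
      IsSmoothOnHalfSpace g → HasRapidSpaceTimeDecay g →
      0 ≤ R → (∀ t x, R < ‖x‖ → g t x = 0) →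
      0 ≤ M → (∀ t ∈ Icc t₀ t₁, ∀ x, ‖g t x‖ ≤ M) →
      (eLpNorm u₀ 3 volume).toReal / ν +
          Real.sqrt (t₁ - t₀) * M * R ^ 2 / ν ^ (3 / 2 : ℝ) +
          (t₁ - t₀) ^ (3 / 4 : ℝ) * M * R ^ (3 / 2 : ℝ) / ν ^ (5 / 4 : ℝ) ≤ ε →
      ∃ (v : ℝ → EuclideanSpace ℝ (Fin 3) → EuclideanSpace ℝ (Fin 3))
        (q : ℝ → EuclideanSpace ℝ (Fin 3) → ℝ),
        IsClassicalNSSolutionOn (Icc t₀ t₁) ν g v q ∧ v t₀ = u₀ ∧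
        (∃ B : ℝ, ∀ t ∈ Icc t₀ t₁, ∀ x, ‖v t x‖ ≤ B) ∧
        (∃ C : ℝ≥0∞, C < ⊤ ∧ ∀ t ∈ Icc t₀ t₁, ∫⁻ x, ‖v t x‖ₑ ^ 2 ≤ C) ∧
        ∀ x, ‖v t₁ x‖ ≤ ε⁻¹ *
          ((eLpNorm u₀ 3 volume).toReal / ν +
            Real.sqrt (t₁ - t₀) * M * R ^ 2 / ν ^ (3 / 2 : ℝ) +
            (t₁ - t₀) ^ (3 / 4 : ℝ) * M * R ^ (3 / 2 : ℝ) / ν ^ (5 / 4 : ℝ)) *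
          Real.sqrt (ν / (t₁ - t₀))

/-! ## §2 The class of tiny anchored level-`0` hosts (construction target) -/

/-- **TINY ANCHORED HOSTS** (construction target; built in the companion file): for every `δ > 0` there is
a pinned (`Λ = 8`, `θ = 6/5`), rigid, quiet schedule on the wide-base rates whose ball has radius in
`[0, δ]` and which carries a registered, globally anchored LEVEL-`0` stage at unit viscosity whose readout
slice `u(τ₀)` is compactly supported with `‖u(τ₀)‖_{L³} ≤ δ` — a level-`0` host of arbitrarily small
scale-invariant size. [cite: Palasek2026ElementaryModel, §3.3] -/
@[conjecture] def TinyAnchoredHosts : Prop :=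
  ∀ δ : ℝ, 0 < δ →
    ∃ (S : Schedule TowerRates.wide), S.Pins 8 (6 / 5) ∧ S.Rigid ∧ S.Quiet ∧
      0 ≤ S.radius ∧ S.radius ≤ δ ∧
      ∃ s₀ : Stage 1 TowerRates.wide S (Margins.routeG TowerRates.wide) 0,
        HasCompactSupport (s₀.u (S.τ 0)) ∧
        eLpNorm (s₀.u (S.τ 0)) 3 volume ≤ ENNReal.ofReal δ

/-! ## §3 Bookkeeping: the engine on the first window of a rigid schedule -/

/-- On a rigid schedule the first growth window has the fixed length `w₀ = 4bβ log N₁ / A₀`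
(`TowerRates.window 0`), whatever the schedule. [folklore] -/
theorem Schedule.Rigid.τ_one_sub_τ_zero {R : TowerRates} {S : Schedule R} (h : S.Rigid) :
    S.τ 1 - S.τ 0 = R.window 0 := by
  have h1 := h.window_eq 0
  rw [h.c₅_eq] at h1
  simp only [TowerRates.window, zero_add]
  linarith

/-- The velocity scales are positive. [folklore] -/
theorem TowerRates.Y_pos (R : TowerRates) (k : ℕ) : 0 < R.Y k :=
  Real.rpow_pos_of_pos (R.N_pos k) _

end Summit.NavierStokesRegularity.FluidComputer.PalasekTowerClayBridge

end
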